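import Summits.Ventures.Crystal3D.Theorems.StickyWulffConstantCoaxialWallLawWordInstance
import HarnessLib

/-!
# Two word systems at once: cross rigidity and the NET count for a family of roots (v2, in-plane rooting)

HONEST FRAMING. Part of the venture `Summits/Ventures/Crystal3D` (cell `crystal3d-full`), helper for the
crux `CoaxialWallLaw` (stmt-Ventures-19481) of `route-Ventures-StickyWulffConstant`, REGISTERED line
`WallLedgerF` (planner cf-p1 gen 16), open stub `stub_coaxialTwoSlabAdhesion` (general fillings).  Brick W10a
of the v2 (NET) line automaton (memo F-NET-AUTOMATON-v2; 19481-p1 g5's IN-PLANE ROOTING, INBOX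
2026-08-28T00:56Z): to root the automaton at an IN-PLANE slot `w` of the bottom grain (`⟪G₀ w, n⟫ = 0`) the
lamination class can no longer be a word over the bottom root (its first letter `ν₀ = G₀⁻¹ n` would need
`⟪w, ν₀⟫ = +√(2/3)`), so the top grain gets its OWN word system, rooted at the twin frame `G₀ ∘ R_{ν₀}` with a
DESCENDING in-plane root slot — and the abstract count `word_sources_le` is applied to the disjoint union of
the two systems.  Rung credit only; F-C1 not moved.

* `inner_third_of_root_letter` — a letter pushed onto a root (`⟪u, x⟫ = √(2/3)`) meets a model menu normal
  `ν₀` with `⟪u, ν₀⟫ = 0` at `±1/3`;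
* **`word_images_ne_cross`** — CROSS RIGIDITY: if system 2 is rooted at `F₂ [] = F₁ [] ∘ R_{ν₀}` and both root
  slots are orthogonal to `ν₀`, then no class of system 1 has the slot dozen of a class of system 2 (the glued
  list `κ₂ ++ ν₀ :: κ₁.reverse` is a `±1/3`-chain of model menu normals mapping the slots into the slots —
  `foldl_reflect_slots_false`);
* **`word_sources_le_family`** — `word_sources_le` for `K = Σ i : Bool, {κ // WF i κ}` (two word systems
  indexed by `Bool`, each with its equations as in `word_sources_le_lists`), `root = ⟨false, []⟩`,
  `lam = ⟨true, []⟩`, rigidity across systems as a hypothesis (`hcross`, discharged by `word_images_ne_cross`),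
  multiplicity `220`.

WHAT THIS IS NOT: not the stub (the in-plane cell/twin assembly is the next brick); F-C1 not moved.
-/

noncomputable section

namespace Summit.Ventures.Crystal3D.Theorems

open Summit.Ventures.Crystal3D Finset
open Literature.MathematicalPhysics.StatisticalMechanics (fccStacking)
open scoped InnerProductSpace

section Cross

variable {F₁ F₂ : List (EuclideanSpace ℝ (Fin 3)) → (EuclideanSpace ℝ (Fin 3) ≃ₗᵢ[ℝ] EuclideanSpace ℝ (Fin 3))}
  {u₁ u₂ : List (EuclideanSpace ℝ (Fin 3)) → EuclideanSpace ℝ (Fin 3)}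
  {WF₁ WF₂ : List (EuclideanSpace ℝ (Fin 3)) → Prop}

/-- **A root letter meets an in-plane model normal at `±1/3`.** -/
theorem inner_third_of_root_letter {u x ν₀ : EuclideanSpace ℝ (Fin 3)} (hx : ‖x‖ = 1) (hν₀ : ‖ν₀‖ = 1)
    (hxm : ∀ w ∈ fccSlots, ⟪w, x⟫_ℝ = 0 ∨ ⟪w, x⟫_ℝ = Real.sqrt (2 / 3) ∨ ⟪w, x⟫_ℝ = -Real.sqrt (2 / 3))
    (hνm : ∀ w ∈ fccSlots, ⟪w, ν₀⟫_ℝ = 0 ∨ ⟪w, ν₀⟫_ℝ = Real.sqrt (2 / 3) ∨ ⟪w, ν₀⟫_ℝ = -Real.sqrt (2 / 3))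
    (hux : ⟪u, x⟫_ℝ = Real.sqrt (2 / 3)) (huν : ⟪u, ν₀⟫_ℝ = 0) :
    ⟪x, ν₀⟫_ℝ = 1 / 3 ∨ ⟪x, ν₀⟫_ℝ = -1 / 3 := by
  have hr : 0 < Real.sqrt (2 / 3) := Real.sqrt_pos.2 (by norm_num)
  have hmx : ∀ w ∈ fccSlots,
      ⟪(LinearIsometryEquiv.refl ℝ (EuclideanSpace ℝ (Fin 3))) w, x⟫_ℝ = 0 ∨
      ⟪(LinearIsometryEquiv.refl ℝ (EuclideanSpace ℝ (Fin 3))) w, x⟫_ℝ = Real.sqrt (2 / 3) ∨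
      ⟪(LinearIsometryEquiv.refl ℝ (EuclideanSpace ℝ (Fin 3))) w, x⟫_ℝ = -Real.sqrt (2 / 3) := by
    intro w hw; simpa using hxm w hw
  have hmν : ∀ w ∈ fccSlots,
      ⟪(LinearIsometryEquiv.refl ℝ (EuclideanSpace ℝ (Fin 3))) w, ν₀⟫_ℝ = 0 ∨
      ⟪(LinearIsometryEquiv.refl ℝ (EuclideanSpace ℝ (Fin 3))) w, ν₀⟫_ℝ = Real.sqrt (2 / 3) ∨
      ⟪(LinearIsometryEquiv.refl ℝ (EuclideanSpace ℝ (Fin 3))) w, ν₀⟫_ℝ = -Real.sqrt (2 / 3) := by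
    intro w hw; simpa using hνm w hw
  rcases inner_menuNormals (LinearIsometryEquiv.refl ℝ _) hx hν₀ hmx hmν with h | h | h | h
  · have heq : x = ν₀ := (inner_eq_one_iff_of_norm_eq_one (𝕜 := ℝ) hx hν₀).1 h
    rw [heq, huν] at hux
    exact absurd hux hr.ne
  · have heq : ν₀ = -x := eq_neg_of_inner_eq_neg_one' hx hν₀ h
    rw [heq, inner_neg_right, hux] at huν
    linarith
  · exact Or.inl h
  · exact Or.inr h

/-- **Cross rigidity of two word systems sharing a twin junction.**  See the module docstring. -/
theorem word_images_ne_cross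
    (hFc₁ : ∀ μ κ, F₁ (μ :: κ) = ((ℝ ∙ μ)ᗮ.reflection).trans (F₁ κ)) (huc₁ : ∀ μ κ, u₁ (μ :: κ) = -u₁ κ)
    (hWFc₁ : ∀ μ κ, WF₁ (μ :: κ) ↔ (WF₁ κ ∧ ‖μ‖ = 1 ∧
      (∀ w ∈ fccSlots, ⟪w, μ⟫_ℝ = 0 ∨ ⟪w, μ⟫_ℝ = Real.sqrt (2 / 3) ∨ ⟪w, μ⟫_ℝ = -Real.sqrt (2 / 3)) ∧
      ⟪u₁ κ, μ⟫_ℝ = Real.sqrt (2 / 3) ∧ ∀ μ' κ', κ = μ' :: κ' → μ' ≠ -μ))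
    (hFc₂ : ∀ μ κ, F₂ (μ :: κ) = ((ℝ ∙ μ)ᗮ.reflection).trans (F₂ κ)) (huc₂ : ∀ μ κ, u₂ (μ :: κ) = -u₂ κ)
    (hWFc₂ : ∀ μ κ, WF₂ (μ :: κ) ↔ (WF₂ κ ∧ ‖μ‖ = 1 ∧
      (∀ w ∈ fccSlots, ⟪w, μ⟫_ℝ = 0 ∨ ⟪w, μ⟫_ℝ = Real.sqrt (2 / 3) ∨ ⟪w, μ⟫_ℝ = -Real.sqrt (2 / 3)) ∧
      ⟪u₂ κ, μ⟫_ℝ = Real.sqrt (2 / 3) ∧ ∀ μ' κ', κ = μ' :: κ' → μ' ≠ -μ))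
    {ν₀ : EuclideanSpace ℝ (Fin 3)} (hν₀ : ‖ν₀‖ = 1)
    (hν₀m : ∀ w ∈ fccSlots, ⟪w, ν₀⟫_ℝ = 0 ∨ ⟪w, ν₀⟫_ℝ = Real.sqrt (2 / 3) ∨ ⟪w, ν₀⟫_ℝ = -Real.sqrt (2 / 3))
    (hroot : ∀ x, F₂ [] x = F₁ [] (x - (2 * ⟪x, ν₀⟫_ℝ) • ν₀))
    (h₁ : ⟪u₁ [], ν₀⟫_ℝ = 0) (h₂ : ⟪u₂ [], ν₀⟫_ℝ = 0)
    {κ₁ κ₂ : List (EuclideanSpace ℝ (Fin 3))} (hκ₁ : WF₁ κ₁) (hκ₂ : WF₂ κ₂) :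
    (F₁ κ₁ : EuclideanSpace ℝ (Fin 3) → EuclideanSpace ℝ (Fin 3)) '' ↑fccSlots ≠
      (F₂ κ₂ : EuclideanSpace ℝ (Fin 3) → EuclideanSpace ℝ (Fin 3)) '' ↑fccSlots := by
  intro himg
  obtain ⟨hlet₁, hchain₁⟩ := word_letters_of_wf huc₁ hWFc₁ _ hκ₁
  obtain ⟨hlet₂, hchain₂⟩ := word_letters_of_wf huc₂ hWFc₂ _ hκ₂
  have hκ₁u : ∀ μ ∈ κ₁, ‖μ‖ = 1 := fun μ hμ => (hlet₁ μ hμ).1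
  have hκ₂u : ∀ μ ∈ κ₂, ‖μ‖ = 1 := fun μ hμ => (hlet₂ μ hμ).1
  -- the glued list `κ₂ ++ ν₀ :: κ₁.reverse`
  refine foldl_reflect_slots_false (κ₂ ++ ν₀ :: κ₁.reverse) (by simp) ?_ ?_ ?_
  · -- letters
    intro μ hμ
    rcases List.mem_append.1 hμ with h | h
    · exact hlet₂ μ h
    · rcases List.mem_cons.1 h with rfl | h
      · exact ⟨hν₀, hν₀m⟩
      · exact hlet₁ μ (List.mem_reverse.1 h)
  · -- the chain condition
    rw [List.isChain_append]
    refine ⟨hchain₂, ?_, ?_⟩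
    · rw [List.isChain_cons]
      refine ⟨fun y hy => ?_, ?_⟩
      · rw [List.head?_reverse] at hy
        obtain ⟨hy1, hym⟩ := hlet₁ y (List.mem_of_getLast? hy)
        have huy : ⟪u₁ [], y⟫_ℝ = Real.sqrt (2 / 3) :=
          word_inner_u_getLast hWFc₁ κ₁ [] (by rw [List.append_nil]; exact hκ₁) y hy
        rcases inner_third_of_root_letter hy1 hν₀ hym hν₀m huy h₁ with h | h
        · left; rw [real_inner_comm]; exact h
        · right; rw [real_inner_comm]; exact h
      · rw [List.isChain_reverse]
        exact hchain₁.imp fun a b h => by rw [real_inner_comm]; exact h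
    · intro x hx y hy
      simp only [List.head?_cons, Option.mem_def, Option.some.injEq] at hy
      subst hy
      obtain ⟨hx1, hxm⟩ := hlet₂ x (List.mem_of_getLast? hx)
      have hux : ⟪u₂ [], x⟫_ℝ = Real.sqrt (2 / 3) :=
        word_inner_u_getLast hWFc₂ κ₂ [] (by rw [List.append_nil]; exact hκ₂) x hx
      exact inner_third_of_root_letter hx1 hν₀ hxm hν₀m hux h₂
  · -- the glued mirror chain maps the slots into the slots
    intro w hw
    have hmem : (F₂ κ₂ : EuclideanSpace ℝ (Fin 3) → EuclideanSpace ℝ (Fin 3)) w ∈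
        (F₁ κ₁ : EuclideanSpace ℝ (Fin 3) → EuclideanSpace ℝ (Fin 3)) '' ↑fccSlots := by
      rw [himg]; exact Set.mem_image_of_mem _ (Finset.mem_coe.2 hw)
    obtain ⟨w₁, hw₁, heq⟩ := hmem
    rw [Finset.mem_coe] at hw₁
    have e₁ : F₁ κ₁ w₁ = F₁ [] (κ₁.foldl (fun (y : EuclideanSpace ℝ (Fin 3)) μ => y - (2 * ⟪y, μ⟫_ℝ) • μ) w₁) := by
      have := word_F_append_apply hFc₁ κ₁ hκ₁u [] w₁
      rw [List.append_nil] at this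
      exact this
    have e₂ : F₂ κ₂ w = F₁ [] ((κ₂.foldl (fun (y : EuclideanSpace ℝ (Fin 3)) μ => y - (2 * ⟪y, μ⟫_ℝ) • μ) w) -
        (2 * ⟪κ₂.foldl (fun (y : EuclideanSpace ℝ (Fin 3)) μ => y - (2 * ⟪y, μ⟫_ℝ) • μ) w, ν₀⟫_ℝ) • ν₀) := by
      have := word_F_append_apply hFc₂ κ₂ hκ₂u [] w
      rw [List.append_nil] at this
      rw [this, hroot]
    rw [e₁, e₂] at heq
    have heq' := (F₁ []).injective heq
    have key := foldl_reflect_reverse_foldl κ₁ hκ₁u w₁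
    rw [heq'] at key
    rw [List.foldl_append, List.foldl_cons, key]
    exact hw₁

end Cross

section Family

variable {X : Finset (EuclideanSpace ℝ (Fin 3))}
  {F : Bool → List (EuclideanSpace ℝ (Fin 3)) → (EuclideanSpace ℝ (Fin 3) ≃ₗᵢ[ℝ] EuclideanSpace ℝ (Fin 3))}
  {u : Bool → List (EuclideanSpace ℝ (Fin 3)) → EuclideanSpace ℝ (Fin 3)}
  {WF : Bool → List (EuclideanSpace ℝ (Fin 3)) → Prop}
  {next : Bool → List (EuclideanSpace ℝ (Fin 3)) → EuclideanSpace ℝ (Fin 3) → List (EuclideanSpace ℝ (Fin 3))}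
  {P₁ P' P₂ : Finset (EuclideanSpace ℝ (Fin 3))} {t₁ t₂ : EuclideanSpace ℝ (Fin 3)} {R₀ h ρ : ℝ}

open scoped Classical in
/-- **The NET count for two word systems (bottom grain rooted in system `false`, top grain = root of system
`true`).**  See the module docstring. -/
theorem word_sources_le_family {δ : ℝ} (hg : KissingGap δ) (hc : KissingClassification δ)
    (hX : ∀ p ∈ X, ∀ q ∈ X, p ≠ q → 1 ≤ dist p q)
    (hFc : ∀ i μ κ, F i (μ :: κ) = ((ℝ ∙ μ)ᗮ.reflection).trans (F i κ))
    (hu : ∀ i κ, u i κ ∈ fccSlots) (huc : ∀ i μ κ, u i (μ :: κ) = -u i κ)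
    (hWF0 : ∀ i, WF i [])
    (hWFc : ∀ i μ κ, WF i (μ :: κ) ↔ (WF i κ ∧ ‖μ‖ = 1 ∧
      (∀ w ∈ fccSlots, ⟪w, μ⟫_ℝ = 0 ∨ ⟪w, μ⟫_ℝ = Real.sqrt (2 / 3) ∨ ⟪w, μ⟫_ℝ = -Real.sqrt (2 / 3)) ∧
      ⟪u i κ, μ⟫_ℝ = Real.sqrt (2 / 3) ∧ ∀ μ' κ', κ = μ' :: κ' → μ' ≠ -μ))
    (hnext_pop : ∀ i μ κ' (m : EuclideanSpace ℝ (Fin 3)), (F i (μ :: κ')).symm m = -μ → next i (μ :: κ') m = κ')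
    (hnext_push : ∀ i κ (m : EuclideanSpace ℝ (Fin 3)), (∀ μ κ', κ = μ :: κ' → (F i κ).symm m ≠ -μ) →
      next i κ m = (F i κ).symm m :: κ)
    (hcross : ∀ κ κ', WF false κ → WF true κ' →
      (F false κ : EuclideanSpace ℝ (Fin 3) → EuclideanSpace ℝ (Fin 3)) '' ↑fccSlots ≠
      (F true κ' : EuclideanSpace ℝ (Fin 3) → EuclideanSpace ℝ (Fin 3)) '' ↑fccSlots)
    (hup : 0 < (F false [] (u false [])) 2)
    -- the cell
    (hR₀ : 3 ≤ R₀) (hρ : R₀ ≤ ρ)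
    (hcell : ∀ p ∈ X, -(2 * R₀) ≤ p 2 ∧ p 2 ≤ h + 2 * R₀ ∧ p 0 ^ 2 + p 1 ^ 2 ≤ ρ ^ 2)
    (hP₁X : P₁ ⊆ X) (hP₂X : P₂ ⊆ X)
    (hP₁ : ∀ p, p ∈ P₁ ↔ (p ∈ (fun q => F false [] q + t₁) '' fccStacking 1 (Real.sqrt (2 / 3)) ∧
      -(2 * R₀) ≤ p 2 ∧ p 2 ≤ -R₀ ∧ p 0 ^ 2 + p 1 ^ 2 ≤ ρ ^ 2))
    (hP' : ∀ p, p ∈ P' ↔ (p ∈ (fun q => F false [] q + t₁) '' fccStacking 1 (Real.sqrt (2 / 3)) ∧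
      -(2 * R₀) + 1 ≤ p 2 ∧ p 2 ≤ -R₀ - 1 ∧ p 0 ^ 2 + p 1 ^ 2 ≤ (ρ - 1) ^ 2))
    (hP'full : ∀ p ∈ P', ∀ w ∈ fccSlots, p + F false [] w ∈ X)
    (hP₂ : ∀ p, p ∈ P₂ ↔ (p ∈ (fun q => F true [] q + t₂) '' fccStacking 1 (Real.sqrt (2 / 3)) ∧
      h + R₀ ≤ p 2 ∧ p 2 ≤ h + 2 * R₀ ∧ p 0 ^ 2 + p 1 ^ 2 ≤ ρ ^ 2)) :
    (P'.filter fun p => (∀ w ∈ fccSlots, p + F false [] w ∈ X) ∧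
        -R₀ - 1 < (p + F false [] (u false [])) 2 ∧ (p + F false [] (u false [])) 2 < h + R₀ + 1).card ≤
      13 * 220 * (X.filter fun z => (X.filter fun q => dist z q = 1).card ≤ 11 ∧
          -R₀ - 1 - 1 ≤ z 2 ∧ z 2 ≤ h + R₀ + 1 + 1).card +
      (P₂.filter fun s => h + R₀ + 1 ≤ s 2 ∧ s 2 < h + R₀ + 1 + (F true [] (u true [])) 2).card +
      220 * (X.filter fun s => h + R₀ + 1 ≤ s 2 ∧ s 2 ≤ h + R₀ + 1 + 1 ∧ (ρ - 2) ^ 2 < s 0 ^ 2 + s 1 ^ 2).card +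
      220 * (X.filter fun s => -R₀ - 1 - 1 ≤ s 2 ∧ s 2 < -R₀ - 1 ∧ (ρ - 1) ^ 2 < s 0 ^ 2 + s 1 ^ 2).card := by
  -- the class data on the disjoint union of the two systems
  set F' : (Σ i : Bool, {κ : List (EuclideanSpace ℝ (Fin 3)) // WF i κ}) →
      (EuclideanSpace ℝ (Fin 3) ≃ₗᵢ[ℝ] EuclideanSpace ℝ (Fin 3)) := fun k => F k.1 k.2.1 with hF'
  set d' : (Σ i : Bool, {κ : List (EuclideanSpace ℝ (Fin 3)) // WF i κ}) → EuclideanSpace ℝ (Fin 3) :=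
    fun k => F k.1 k.2.1 (u k.1 k.2.1) with hd'
  set next' : (Σ i : Bool, {κ : List (EuclideanSpace ℝ (Fin 3)) // WF i κ}) → EuclideanSpace ℝ (Fin 3) →
      (Σ i : Bool, {κ : List (EuclideanSpace ℝ (Fin 3)) // WF i κ}) := fun k m =>
    @dite _ (WF k.1 (next k.1 k.2.1 m)) (Classical.propDecidable _) (fun hw => ⟨k.1, next k.1 k.2.1 m, hw⟩)
      (fun _ => k) with hnext'
  set root : (Σ i : Bool, {κ : List (EuclideanSpace ℝ (Fin 3)) // WF i κ}) := ⟨false, [], hWF0 false⟩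
    with hroot_def
  set lam' : (Σ i : Bool, {κ : List (EuclideanSpace ℝ (Fin 3)) // WF i κ}) := ⟨true, [], hWF0 true⟩
    with hlam_def
  -- the non-dependent shadow of a class: (system, word)
  set proj : (Σ i : Bool, {κ : List (EuclideanSpace ℝ (Fin 3)) // WF i κ}) → Bool × List (EuclideanSpace ℝ (Fin 3)) :=
    fun k => (k.1, k.2.1) with hproj
  have hproj_inj : ∀ k k' : Σ i : Bool, {κ : List (EuclideanSpace ℝ (Fin 3)) // WF i κ}, proj k = proj k' → k = k' := by
    rintro ⟨i, κ, hκ⟩ ⟨j, κ', hκ'⟩ h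
    simp only [hproj, Prod.mk.injEq] at h
    obtain ⟨rfl, rfl⟩ := h
    rfl
  have hF'proj : ∀ k, F' k = F (proj k).1 (proj k).2 := fun k => rfl
  have hd'proj : ∀ k, d' k = F (proj k).1 (proj k).2 (u (proj k).1 (proj k).2) := fun k => rfl
  -- the class change along a crossing normal
  have hspec : ∀ (k : Σ i : Bool, {κ : List (EuclideanSpace ℝ (Fin 3)) // WF i κ}) (m : EuclideanSpace ℝ (Fin 3)),
      ‖m‖ = 1 →
      (∀ w ∈ fccSlots, ⟪F' k w, m⟫_ℝ = 0 ∨ ⟪F' k w, m⟫_ℝ = Real.sqrt (2 / 3) ∨ ⟪F' k w, m⟫_ℝ = -Real.sqrt (2 / 3)) →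
      ⟪d' k, m⟫_ℝ = Real.sqrt (2 / 3) →
      proj (next' k m) = (k.1, next k.1 k.2.1 m) ∧
      (∀ x, F k.1 (next k.1 k.2.1 m) x = F k.1 k.2.1 x - (2 * ⟪F k.1 k.2.1 x, m⟫_ℝ) • m) ∧
        ⟪F k.1 (next k.1 k.2.1 m) (u k.1 (next k.1 k.2.1 m)), m⟫_ℝ = Real.sqrt (2 / 3) ∧
        next k.1 (next k.1 k.2.1 m) m = k.2.1 := by
    intro k m hm hmenu hdm
    obtain ⟨hwf, hfr, hdir, hinv⟩ :=
      word_next_spec (hFc k.1) (huc k.1) (hWFc k.1) (hnext_pop k.1) (hnext_push k.1) k.2.2 hm hmenu hdm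
    refine ⟨?_, hfr, hdir, hinv⟩
    simp only [hnext', hproj]
    rw [dif_pos hwf]
  have hmirror : ∀ (k : Σ i : Bool, {κ : List (EuclideanSpace ℝ (Fin 3)) // WF i κ}) (m : EuclideanSpace ℝ (Fin 3)),
      ‖m‖ = 1 →
      (∀ w ∈ fccSlots, ⟪F' k w, m⟫_ℝ = 0 ∨ ⟪F' k w, m⟫_ℝ = Real.sqrt (2 / 3) ∨ ⟪F' k w, m⟫_ℝ = -Real.sqrt (2 / 3)) →
      ⟪d' k, m⟫_ℝ = Real.sqrt (2 / 3) → ∀ x, F' (next' k m) x = F' k x - (2 * ⟪F' k x, m⟫_ℝ) • m := by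
    intro k m hm hmenu hdm x
    obtain ⟨h1, hfr, -, -⟩ := hspec k m hm hmenu hdm
    rw [hF'proj (next' k m), h1]
    exact hfr x
  have hinv : ∀ (k : Σ i : Bool, {κ : List (EuclideanSpace ℝ (Fin 3)) // WF i κ}) (m : EuclideanSpace ℝ (Fin 3)),
      ‖m‖ = 1 →
      (∀ w ∈ fccSlots, ⟪F' k w, m⟫_ℝ = 0 ∨ ⟪F' k w, m⟫_ℝ = Real.sqrt (2 / 3) ∨ ⟪F' k w, m⟫_ℝ = -Real.sqrt (2 / 3)) →
      ⟪d' k, m⟫_ℝ = Real.sqrt (2 / 3) → next' (next' k m) m = k := by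
    intro k m hm hmenu hdm
    obtain ⟨h1, hfr, hdir, hback⟩ := hspec k m hm hmenu hdm
    -- the new class crosses `m` again, so the second step is again a genuine class change
    have hmenu' : ∀ w ∈ fccSlots, ⟪F' (next' k m) w, m⟫_ℝ = 0 ∨ ⟪F' (next' k m) w, m⟫_ℝ = Real.sqrt (2 / 3) ∨
        ⟪F' (next' k m) w, m⟫_ℝ = -Real.sqrt (2 / 3) := by
      intro w hw
      rw [hF'proj (next' k m), h1]
      simp only
      rw [hfr w, inner_sub_left, real_inner_smul_left, real_inner_self_eq_norm_sq, hm]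
      rcases hmenu w hw with h0 | h0 | h0
      · left; rw [show ⟪F' k w, m⟫_ℝ = ⟪F k.1 k.2.1 w, m⟫_ℝ from rfl] at h0; rw [h0]; ring
      · right; right; rw [show ⟪F' k w, m⟫_ℝ = ⟪F k.1 k.2.1 w, m⟫_ℝ from rfl] at h0; rw [h0]; ring
      · right; left; rw [show ⟪F' k w, m⟫_ℝ = ⟪F k.1 k.2.1 w, m⟫_ℝ from rfl] at h0; rw [h0]; ring
    have hdm' : ⟪d' (next' k m), m⟫_ℝ = Real.sqrt (2 / 3) := by
      rw [hd'proj (next' k m), h1]; exact hdir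
    obtain ⟨h2, -, -, -⟩ := hspec (next' k m) m hm hmenu' hdm'
    apply hproj_inj
    rw [h2]
    have h3 : ((next' k m).1, (next' k m).2.1) = (k.1, next k.1 k.2.1 m) := h1
    obtain ⟨e1, e2⟩ := Prod.mk.inj h3
    rw [e2, e1, hback]
  have hdnext : ∀ (k : Σ i : Bool, {κ : List (EuclideanSpace ℝ (Fin 3)) // WF i κ}) (m : EuclideanSpace ℝ (Fin 3)),
      ‖m‖ = 1 →
      (∀ w ∈ fccSlots, ⟪F' k w, m⟫_ℝ = 0 ∨ ⟪F' k w, m⟫_ℝ = Real.sqrt (2 / 3) ∨ ⟪F' k w, m⟫_ℝ = -Real.sqrt (2 / 3)) →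
      ⟪d' k, m⟫_ℝ = Real.sqrt (2 / 3) → ⟪d' (next' k m), m⟫_ℝ = Real.sqrt (2 / 3) := by
    intro k m hm hmenu hdm
    obtain ⟨h1, -, hdir, -⟩ := hspec k m hm hmenu hdm
    rw [hd'proj (next' k m), h1]; exact hdir
  have hd : ∀ k : Σ i : Bool, {κ : List (EuclideanSpace ℝ (Fin 3)) // WF i κ}, ∃ u' ∈ fccSlots, d' k = F' k u' :=
    fun k => ⟨u k.1 k.2.1, hu k.1 k.2.1, rfl⟩
  have hdn : ∀ k : Σ i : Bool, {κ : List (EuclideanSpace ℝ (Fin 3)) // WF i κ}, ∃ m : EuclideanSpace ℝ (Fin 3),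
      ‖m‖ = 1 ∧
      (∀ w ∈ fccSlots, ⟪F' k w, m⟫_ℝ = 0 ∨ ⟪F' k w, m⟫_ℝ = Real.sqrt (2 / 3) ∨ ⟪F' k w, m⟫_ℝ = -Real.sqrt (2 / 3)) ∧
      ⟪d' k, m⟫_ℝ = Real.sqrt (2 / 3) := fun k => exists_menuNormal_far (F k.1 k.2.1) (hu k.1 k.2.1)
  -- rigidity: the slot dozen determines the system and the word
  have hinjK : ∀ k k' : Σ i : Bool, {κ : List (EuclideanSpace ℝ (Fin 3)) // WF i κ},
      (F' k : EuclideanSpace ℝ (Fin 3) → EuclideanSpace ℝ (Fin 3)) '' ↑fccSlots =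
      (F' k' : EuclideanSpace ℝ (Fin 3) → EuclideanSpace ℝ (Fin 3)) '' ↑fccSlots → k = k' := by
    rintro ⟨i, κ, hκ⟩ ⟨j, κ', hκ'⟩ himg
    have hij : i = j := by
      cases i <;> cases j
      · rfl
      · exact absurd himg (hcross κ κ' hκ hκ')
      · exact absurd himg.symm (hcross κ' κ hκ' hκ)
      · rfl
    subst hij
    have hκκ : κ = κ' := word_eq_of_image_eq (hFc i) (huc i) (hWFc i) hκ hκ' himg
    subst hκκ
    rfl
  have hrig : ∀ k k' : Σ i : Bool, {κ : List (EuclideanSpace ℝ (Fin 3)) // WF i κ},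
      (∃ a ∈ fccSlots, ∃ a' ∈ fccSlots, ∃ a'' ∈ fccSlots,
        ⟪a, a'⟫_ℝ = 1 / 2 ∧ ⟪a, a''⟫_ℝ = 1 / 2 ∧ ⟪a', a''⟫_ℝ = 1 / 2 ∧
        (∃ w ∈ fccSlots, F' k' w = F' k a) ∧ (∃ w ∈ fccSlots, F' k' w = F' k a') ∧
        (∃ w ∈ fccSlots, F' k' w = F' k a'')) → k = k' := by
    intro k k' htri
    obtain ⟨a, ha, a', ha', a'', ha'', i1, i2, i3, ⟨w₁, hw₁, e₁⟩, ⟨w₂, hw₂, e₂⟩, ⟨w₃, hw₃, e₃⟩⟩ := htri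
    exact hinjK k k' (image_fccSlots_eq_of_triangle (F' k) (F' k') ha ha' ha'' i1 i2 i3
      ⟨w₁, Finset.mem_coe.2 hw₁, e₁⟩ ⟨w₂, Finset.mem_coe.2 hw₂, e₂⟩ ⟨w₃, Finset.mem_coe.2 hw₃, e₃⟩)
  -- the certified states and the move map
  obtain ⟨W, hW, hmult⟩ := exists_certified_states (F := F') (d := d') hX hinjK
  obtain ⟨f, hf_full, hf_cross, hf_glide⟩ := exists_word_move_map X F' d' next'
  -- the abstract count
  have key := word_sources_le (root := root) (lam := lam') hg hc hX hd hdn hmirror hinv hdnext hW hmult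
    (fun v _ => hf_full v) (fun v _ => hf_cross v) (fun v _ => hf_glide v)
    (fun κ hκ => hrig κ root hκ) (fun κ hκ => hrig κ lam' hκ) hup hR₀ hρ hcell hP₁X hP₂X hP₁ hP' hP'full hP₂
  exact key

end Family

end Summit.Ventures.Crystal3D.Theorems

end
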